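import Summits.ValiantsHypothesis.ValiantsHypothesis.Theorems.KPlusLogSqLawTropicalBBoundarySectorCounting

/-!
# Route «KPlusLogSqLaw», crux `TropicalB` (stmt-ValiantsHypothesis-19771) — boundary-type sector: the SHARP counting ceiling
# `BoundaryVertexLaw B (2^B − 1)`

HONEST FRAMING.  Helper toward the registered stubs of `Cruxes/TropicalB/Lines/birth.lean` (crux
`Summit.ValiantsHypothesis.ValiantsHypothesis.Theses.KPlusLogSqLaw.TropicalB`, item `stmt-ValiantsHypothesis-19771`, route `KPlusLogSqLaw`,
DRAFT; cell `pub-symmetroid`, seat val-sym-trop-p1 g2).  Sharpens `BoundarySector.boundaryVertexLaw_counting` (`BoundaryVertexLaw B (2^B)`,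
file `…BoundarySectorCounting`) by one exponent: the pattern-count vector of a term sums to `m`, so one coordinate is redundant.
Consequently the sector theorem handed to the trop-p2 successor, `BoundaryVertexLaw 2 2`, is EXACTLY one exponent below the counting
ceiling `BoundaryVertexLaw 2 3` proved here (and `BoundaryVertexLaw 1 1`, `BoundaryVertexLaw 0 0` of the Defs file are the counting
ceilings for `B ≤ 1`, where nothing is open).

* `BoundarySector.sum_patternCount` — `Σ_P #{b : pattern (σ b) b = P} = m`;
* `BoundarySector.designRowD_boundary_sharp` — unsigned row bound `(m+1)^{2^B − 1} − 1` (for `B ≥ 1`; drop the all-`false` pattern's count);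
* `BoundarySector.boundaryVertexLaw_sharpCounting` — `∀ B, BoundaryVertexLaw B (2^B − 1)` with constant `1`.
Nothing here is in-window; nothing bears on `TropicalB`, `KPlusLogSqLaw`, `Lifting`, DoorA26 / DoorA34, `MatrixDescartes`
(`stmt-ValiantsHypothesis-18050`) or VP ≠ VNP.  [folklore: slope counting]
-/

-- `Summit.ValiantsHypothesis.ValiantsHypothesis.…` repeats a component by the D-0017 layout
-- (single-conjunct summit), which the `dupNamespace` linter flags; the name is mandated.
set_option linter.dupNamespace false
set_option autoImplicit false

namespace Summit.ValiantsHypothesis.ValiantsHypothesis.Theorems.KPlusLogSqLaw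

open Summit.ValiantsHypothesis.ValiantsHypothesis.Theorems.MatrixDescartes.Negative
open Summit.ValiantsHypothesis.ValiantsHypothesis.Theorems.LacunarySymmetroidMatrixDescartes
open Finset

namespace BoundarySector

variable {m K B : ℕ}

/-- The pattern counts of a term sum to `m` (every column has exactly one pattern). [folklore] -/
theorem sum_patternCount (π ρ : Fin B → Equiv.Perm (Fin m)) (σ : Equiv.Perm (Fin m)) :
    ∑ P : Fin B → Bool, (univ.filter fun b : Fin m => pattern π ρ (σ b) b = P).card = m := by
  classical
  have h := card_eq_sum_card_fiberwise (s := (univ : Finset (Fin m))) (t := (univ : Finset (Fin B → Bool)))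
    (f := fun b : Fin m => pattern π ρ (σ b) b) (fun b _ => mem_univ _)
  rw [card_univ, Fintype.card_fin] at h
  exact h.symm

/-- **Sharp counting ceiling.**  For `B ≥ 1`, a boundary-type design with `B` boundaries has unsigned row bound `(m+1)^{2^B − 1} − 1`:
the pattern-count vector restricted to the patterns other than the all-`false` one is already injective along a chain. [folklore] -/
theorem designRowD_boundary_sharp (hB : 1 ≤ B) (π ρ : Fin B → Equiv.Perm (Fin m)) (lab : (Fin B → Bool) → Fin K)
    (d : Fin K → ℕ) (v ε : Fin m → Fin m → Fin K → ℤ) (hε : IsBoundaryDesign π ρ lab ε) :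
    DesignRowD d v ε ((m + 1) ^ (2 ^ B - 1) - 1) := by
  classical
  intro n θ p hθ hdom hne
  have hsm := slope_strictMono_of_chainD d v ε θ p hθ hdom hne
  -- the distinguished pattern (all `false`) and the restricted count vector
  let P₀ : Fin B → Bool := fun _ => false
  have hcle : ∀ (k : Fin (n + 1)) (P : Fin B → Bool),
      (univ.filter fun b : Fin m => pattern π ρ ((p k).1 b) b = P).card < m + 1 := fun k P =>
    Nat.lt_succ_of_le ((card_filter_le _ _).trans (by rw [card_univ, Fintype.card_fin]))
  let cnt : Fin (n + 1) → ({P : Fin B → Bool // P ≠ P₀} → Fin (m + 1)) := fun k P =>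
    ⟨(univ.filter fun b : Fin m => pattern π ρ ((p k).1 b) b = P.1).card, hcle k P.1⟩
  -- full counts are recovered from the restricted ones (they sum to `m`)
  have hfull : ∀ k k' : Fin (n + 1), cnt k = cnt k' → ∀ P : Fin B → Bool,
      (univ.filter fun b : Fin m => pattern π ρ ((p k).1 b) b = P).card =
        (univ.filter fun b : Fin m => pattern π ρ ((p k').1 b) b = P).card := by
    intro k k' h P
    have hrest : ∀ P : Fin B → Bool, P ≠ P₀ →
        (univ.filter fun b : Fin m => pattern π ρ ((p k).1 b) b = P).card =
          (univ.filter fun b : Fin m => pattern π ρ ((p k').1 b) b = P).card := by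
      intro P hP
      have := congrArg (fun f => ((f ⟨P, hP⟩ : Fin (m + 1)) : ℕ)) h
      simpa [cnt] using this
    by_cases hP : P = P₀
    · -- the distinguished count is `m − Σ others` on both sides
      have hk := sum_patternCount π ρ (p k).1
      have hk' := sum_patternCount π ρ (p k').1
      rw [← Finset.sum_erase_add _ _ (mem_univ P₀)] at hk hk'
      have heq : ∑ Q ∈ univ.erase P₀, (univ.filter fun b : Fin m => pattern π ρ ((p k).1 b) b = Q).card =
          ∑ Q ∈ univ.erase P₀, (univ.filter fun b : Fin m => pattern π ρ ((p k').1 b) b = Q).card :=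
        sum_congr rfl fun Q hQ => hrest Q (ne_of_mem_erase hQ)
      subst hP
      omega
    · exact hrest P hP
  have hinj : Function.Injective cnt := by
    intro k k' h
    apply hsm.injective
    simp only
    rw [slope_eq_sum_patternCount d hε (hdom k).1, slope_eq_sum_patternCount d hε (hdom k').1]
    exact sum_congr rfl fun P _ => by rw [hfull k k' h P]
  have hcard := Fintype.card_le_of_injective cnt hinj
  have hsub : Fintype.card {P : Fin B → Bool // P ≠ P₀} = 2 ^ B - 1 := by
    rw [Fintype.card_subtype_compl, Fintype.card_fun, Fintype.card_bool, Fintype.card_fin, Fintype.card_unique]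
  rw [Fintype.card_fin, Fintype.card_fun, hsub, Fintype.card_fin] at hcard
  have hpos : 1 ≤ (m + 1) ^ (2 ^ B - 1) := Nat.one_le_pow _ _ (Nat.succ_pos m)
  have _ := hB
  omega

/-- **`BoundaryVertexLaw B (2^B − 1)`** with constant `1` — the SHARP counting ceiling of the boundary-type sector (for `B = 0` this is
the base case `boundaryVertexLaw_zero`). [folklore] -/
theorem boundaryVertexLaw_sharpCounting (B : ℕ) : BoundaryVertexLaw B (2 ^ B - 1) := by
  classical
  rcases Nat.eq_zero_or_pos B with hB | hB
  · subst hB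
    simpa using boundaryVertexLaw_zero
  refine ⟨1, fun m K π ρ lab d v ε hε => ?_⟩
  have h := card_dominant_le_succ d v ε (designRowD_boundary_sharp hB π ρ lab d v ε hε)
  have hpos : 1 ≤ (m + 1) ^ (2 ^ B - 1) := Nat.one_le_pow _ _ (Nat.succ_pos m)
  rw [one_mul]
  omega

end BoundarySector

end Summit.ValiantsHypothesis.ValiantsHypothesis.Theorems.KPlusLogSqLaw
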